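import Literature.NumberTheory.LFunctions.ClassGroupLFunctionFunctionalEquation
import Literature.NumberTheory.LFunctions.DedekindZetaEntireConvexity
import Literature.NumberTheory.LFunctions.DedekindZetaFiniteOrderProofs
import HarnessLib

/-!
# The uniform convexity bound for the class-twisted zeta functions, in particular for the
# `L`-functions of class group characters

Topic `Literature/NumberTheory/LFunctions` (namespace `Literature.NumberTheory.LFunctions.NumberField`),
continuing `ClassGroupLFunctionFunctionalEquation.lean` (`Z_a(s) = Σ_C a(C) ζ(C, s)`,
`Λ_a(1 − s) = Λ_{a∘σ⁻¹}(s)`) and following `DedekindZetaEntireConvexity.lean` (the case `a = 1`,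
`ζ_K`) line by line.  Everything here is PROVED (one definition with body, theorems).

For a coefficient function `a : Cl_K → ℂ` with `|a| ≤ 1` (a class group character, say) we set up
the entire function `Z₁_a(s) = Σ_C a(C) E_C(s) (= (s − 1) Z_a(s))` (`classTwistedZeta₁`;
`E_C = classSumEntire`) and prove the **convexity bound, uniform in `K` and in `a`**:

* `norm_classTwistedZeta_eq_of_re_eq_neg_half` — on `Re s = −1/2`,
  `|Z_a(s)| = |d_K| (|s|/2π)^{r₁} (|s||s+1|/4π²)^{r₂} |Z_{a∘σ}(1 − s)|` (exact modulus of the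
  functional equation, Rademacher's device — no Stirling);
* `sum_norm_classSumCont_le` — `Σ_C |ζ(C, s)| ≤ e^{n_K/(σ − 1)}` for `σ > 1` (so
  `|Z_a(s)| ≤ e^{n_K/(σ−1)}`, `norm_classTwistedZeta_le_exp`);
* `growth_classTwistedZeta₁` — `Z₁_a` has growth `exp(O(‖s‖²))` on vertical strips;
* `norm_classTwistedZeta₁_le` — **for `Re z ≥ −1/2`,
  `|Z₁_a(z)| ≤ |d_K| · e^{2 n_K} · |z + 5/2|^{n_K + 1}`** (Rademacher's Phragmén–Lindelöf theorem on
  `[−1/2, 3/2]` with `Q = 5/2`), and `norm_sub_one_mul_classGroupLFunction_le` — the same for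
  `(s − 1) L(s, χ)`, every class group character `χ`, every number field `K`.

This is the growth input (polynomial in `Q = |d_K|` and `|t|`) of the zero-counting and
zero-free-region arguments for `L(s, χ, H_K/K)` ([ThornerZaman2019, Lemmas 2.5–2.6, Thm. 3.1],
there quoted from [LO] and [Weiss]).

## References

* H. Rademacher, *On the Phragmén–Lindelöf theorem and some applications*, Math. Z. 72 (1959),
  Theorems 2 and 4. [Rademacher1959]
* J. Thorner, A. Zaman, *A unified and improved Chebotarev density theorem*, ANT 13 (2019), §2.3.
  [ThornerZaman2019]
-/

noncomputable section

open scoped NumberField nonZeroDivisors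
open NumberField NumberField.InfinitePlace NumberField.Units Complex Filter Topology Set Metric

namespace Literature.NumberTheory.LFunctions.NumberField

variable (K : Type*) [Field K] [NumberField K]

/-! ### The entire function `Z₁_a(s) = Σ_C a(C) E_C(s) = (s − 1) Z_a(s)` -/

/-- `Z₁_a(s) = Σ_C a(C) E_C(s)`, `E_C(s) = (s − 1) ζ(C, s)` made entire (`classSumEntire`): the entire
function `(s − 1) Z_a(s)` (`classTwistedZeta₁_apply_of_ne_one`). [cite: NeukirchANT1999, Ch. VII (5.11)] -/
def classTwistedZeta₁ (a : ClassGroup (𝓞 K) → ℂ) (s : ℂ) : ℂ :=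
  ∑ C : ClassGroup (𝓞 K), a C * classSumEntire (thetaIdeal_inv_holds K) C s

variable {K}

/-- `Z₁_a` is entire. [folklore] -/
theorem differentiable_classTwistedZeta₁ (a : ClassGroup (𝓞 K) → ℂ) :
    Differentiable ℂ (classTwistedZeta₁ K a) := by
  have : classTwistedZeta₁ K a = fun s ↦
      ∑ C : ClassGroup (𝓞 K), a C * classSumEntire (thetaIdeal_inv_holds K) C s := by
    funext s; rfl
  rw [this]
  exact Differentiable.fun_sum fun C _ ↦
    (differentiable_const _).mul (differentiable_classSumEntire (thetaIdeal_inv_holds K) C)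

/-- `Z₁_a(s) = (s − 1) Z_a(s)` for `s ≠ 1`. [folklore] -/
theorem classTwistedZeta₁_apply_of_ne_one (a : ClassGroup (𝓞 K) → ℂ) {s : ℂ} (hs : s ≠ 1) :
    classTwistedZeta₁ K a s = (s - 1) * classTwistedZeta K a s := by
  rw [classTwistedZeta₁, classTwistedZeta, Finset.mul_sum]
  refine Finset.sum_congr rfl fun C _ ↦ ?_
  rw [classSumEntire_eq_sub_one_mul _ C hs]
  ring

/-- `(s − 1) L(s, χ) = Z₁_χ(s)` for `s ≠ 1`. [folklore] -/
theorem sub_one_mul_classGroupLFunction (χ : ClassGroup (𝓞 K) →* ℂˣ) {s : ℂ} (hs : s ≠ 1) :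
    (s - 1) * classGroupLFunction K χ s = classTwistedZeta₁ K (fun C ↦ (χ C : ℂ)) s := by
  rw [classTwistedZeta₁_apply_of_ne_one _ hs, classGroupLFunction_eq_classTwistedZeta]

/-! ### Growth `exp(O(‖s‖²))` on vertical strips (the a-priori finite order) -/

/-- `E_C(s)` has growth `exp(O(‖s‖²))` on every vertical strip (the class summand of the tree's
`growth_sum_classSumEntire`). [folklore] -/
theorem growth_classSumEntire (hinv : thetaIdeal_inv K) (C : ClassGroup (𝓞 K)) {R : ℝ} (hR : 0 ≤ R) :
    ∃ A c : ℝ, 0 ≤ A ∧ 0 ≤ c ∧ ∀ s ∈ {s : ℂ | |s.re| ≤ R},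
      ‖(fun s ↦ classSumEntire hinv C s) s‖ ≤ A * Real.exp (c * ‖s‖ ^ 2) := by
  set D : Set ℂ := {s : ℂ | |s.re| ≤ R} with hD
  have key := growth_sub
    (growth_mul (growth_classFrontFactor C hR)
      (growth_add (growth_mul (growth_sub_one D) (growth_Λ₀_half (classPair hinv C) hR))
        (growth_const D (2 * (classPair hinv C).ε))))
    (growth_mul (growth_sub_one D) (growth_classFrontFactor₀ C hR))
  refine growth_of_le (fun s _ ↦ le_of_eq ?_) key
  show ‖classSumEntire hinv C s‖ = _
  rw [classSumEntire]
  rfl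

/-- **`Z₁_a` has growth `exp(O(‖s‖²))` on every vertical strip `|Re s| ≤ R`** (finite weighted sum
of the `E_C`). [folklore] -/
theorem growth_classTwistedZeta₁ (a : ClassGroup (𝓞 K) → ℂ) {R : ℝ} (hR : 0 ≤ R) :
    ∃ A c : ℝ, 0 ≤ A ∧ 0 ≤ c ∧ ∀ s ∈ {s : ℂ | |s.re| ≤ R},
      ‖classTwistedZeta₁ K a s‖ ≤ A * Real.exp (c * ‖s‖ ^ 2) := by
  set D : Set ℂ := {s : ℂ | |s.re| ≤ R} with hD
  have h := growth_sum (Finset.univ : Finset (ClassGroup (𝓞 K)))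
    (F := fun C s ↦ a C * classSumEntire (thetaIdeal_inv_holds K) C s) fun C _ ↦
      growth_mul (growth_const D (a C)) (growth_classSumEntire (thetaIdeal_inv_holds K) C hR)
  refine growth_of_le (fun s _ ↦ le_of_eq ?_) h
  rfl

/-- The a-priori finite order in the form consumed by Rademacher's theorem: on the strip
`|Re s| ≤ 4`, `|Z₁_a(s)| ≤ C e^{|Im s|^4}`. [folklore] -/
theorem exists_norm_classTwistedZeta₁_le_exp_im (a : ClassGroup (𝓞 K) → ℂ) :
    ∃ C : ℝ, 0 < C ∧ ∀ s : ℂ, |s.re| ≤ 4 → ‖classTwistedZeta₁ K a s‖ ≤ C * Real.exp (|s.im| ^ (4 : ℝ)) := by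
  obtain ⟨A, c, hA, hc, h⟩ := growth_classTwistedZeta₁ a (R := 4) (by norm_num)
  obtain ⟨K₁, hK₁, hK⟩ := Literature.Analysis.Complex.exists_exp_norm_rpow_le 4 3 (by norm_num)
    (by norm_num)
  refine ⟨(A + 1) * Real.exp (c ^ 3) * K₁, by positivity, fun s hs ↦ ?_⟩
  have h1 := h s hs
  -- `exp(c ‖s‖²) ≤ exp(c³) exp(‖s‖³)`
  have h2 : Real.exp (c * ‖s‖ ^ 2) ≤ Real.exp (c ^ 3) * Real.exp (‖s‖ ^ (3 : ℝ)) := by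
    rw [← Real.exp_add, Real.exp_le_exp]
    have hn : 0 ≤ ‖s‖ := norm_nonneg s
    rw [show (3 : ℝ) = ((3 : ℕ) : ℝ) by norm_num, Real.rpow_natCast]
    rcases le_or_gt ‖s‖ c with hsc | hsc
    · nlinarith [mul_le_mul_of_nonneg_left (mul_le_mul hsc hsc hn (hn.trans hsc)) hc,
        pow_nonneg hn 3]
    · nlinarith [mul_le_mul_of_nonneg_right hsc.le (sq_nonneg ‖s‖), Real.exp_nonneg (c^3),
        pow_nonneg hc 3]
  have h3 := hK s hs
  rw [show (3 : ℝ) + 1 = 4 by norm_num] at h3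
  calc ‖classTwistedZeta₁ K a s‖ ≤ A * Real.exp (c * ‖s‖ ^ 2) := h1
    _ ≤ (A + 1) * (Real.exp (c ^ 3) * Real.exp (‖s‖ ^ (3 : ℝ))) := by
        refine mul_le_mul (by linarith) h2 (Real.exp_nonneg _) (by linarith)
    _ ≤ (A + 1) * (Real.exp (c ^ 3) * (K₁ * Real.exp (|s.im| ^ (4 : ℝ)))) := by gcongr
    _ = (A + 1) * Real.exp (c ^ 3) * K₁ * Real.exp (|s.im| ^ (4 : ℝ)) := by ring

/-! ### The right half-plane: `Σ_C |ζ(C, s)| ≤ e^{n_K/(σ − 1)}` -/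

/-- For `Re s > 1`: `Σ_C |ζ(C, s)| ≤ |ζ_K(σ)|`, `σ = Re s` (termwise `|N𝔟^{-s}| = N𝔟^{-σ}`, the
classes partition the nonzero ideals). [folklore] -/
theorem sum_norm_classSumCont_le_norm_dedekindZeta {s : ℂ} (hs : 1 < s.re) :
    ∑ C : ClassGroup (𝓞 K), ‖classSumCont (thetaIdeal_inv_holds K) C s‖ ≤
      ‖dedekindZeta K (s.re : ℂ)‖ := by
  classical
  have hσ : 1 < ((s.re : ℂ)).re := by simpa using hs
  -- the real majorant family on the nonzero ideals
  set g : (Ideal (𝓞 K))⁰ → ℝ := fun I ↦ ((Ideal.absNorm (I : Ideal (𝓞 K)) : ℕ) : ℝ) ^ (-s.re) with hg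
  have hg0 : ∀ I, 0 ≤ g I := fun I ↦ Real.rpow_nonneg (Nat.cast_nonneg _) _
  have hnorm : ∀ I : (Ideal (𝓞 K))⁰,
      ‖((Ideal.absNorm (I : Ideal (𝓞 K)) : ℕ) : ℂ) ^ (-s)‖ = g I := by
    intro I
    have hpos : 0 < Ideal.absNorm (I : Ideal (𝓞 K)) := Ideal.absNorm_pos_of_nonZeroDivisors I
    rw [hg, Complex.norm_natCast_cpow_of_pos hpos, Complex.neg_re]
  have hnormσ : ∀ I : (Ideal (𝓞 K))⁰,
      ((Ideal.absNorm (I : Ideal (𝓞 K)) : ℕ) : ℂ) ^ (-(s.re : ℂ)) = ((g I : ℝ) : ℂ) := by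
    intro I
    rw [hg, ← Complex.ofReal_natCast, ← Complex.ofReal_neg, ← Complex.ofReal_cpow (Nat.cast_nonneg _)]
  -- summability of `g` and its sum `= ζ_K(σ)`
  have hsumC := (Literature.NumberTheory.LFunctions.hasSum_absNorm_cpow K hσ)
  have h2 : HasSum (fun I : (Ideal (𝓞 K))⁰ ↦ ((Ideal.absNorm (I : Ideal (𝓞 K)) : ℕ) : ℂ) ^ (-(s.re : ℂ)))
      (dedekindZeta K (s.re : ℂ)) := by
    have hs0 : -(s.re : ℂ) ≠ 0 := by
      rw [neg_ne_zero, Ne, Complex.ofReal_eq_zero]; linarith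
    refine (Function.Injective.hasSum_iff Subtype.val_injective fun I hI ↦ ?_).mpr hsumC
    have hI0 : I = 0 := by
      by_contra h
      exact hI ⟨⟨I, mem_nonZeroDivisors_iff_ne_zero.mpr h⟩, rfl⟩
    rw [hI0, Submodule.zero_eq_bot, Ideal.absNorm_bot, Nat.cast_zero, Complex.zero_cpow hs0]
  have hgsum : HasSum g (dedekindZeta K (s.re : ℂ)).re := by
    have := h2.mapL Complex.reCLM
    simp only [Complex.reCLM_apply] at this
    refine this.congr_fun fun I ↦ ?_
    rw [hnormσ I, Complex.ofReal_re]
  -- per class: `‖ζ(C, s)‖ ≤ Σ'_{I ∈ C} g I`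
  have hclass : ∀ C : ClassGroup (𝓞 K), ‖classSumCont (thetaIdeal_inv_holds K) C s‖ ≤
      ∑' I : {I : (Ideal (𝓞 K))⁰ // ClassGroup.mk0 I = C}, g I.1 := by
    intro C
    rw [classSumCont_eq_tsum _ C hs]
    have hsg : Summable fun I : {I : (Ideal (𝓞 K))⁰ // ClassGroup.mk0 I = C} ↦ g I.1 :=
      hgsum.summable.comp_injective Subtype.val_injective
    refine (norm_tsum_le_tsum_norm ?_).trans (le_of_eq (tsum_congr fun I ↦ hnorm I.1))
    exact hsg.congr fun I ↦ (hnorm I.1).symm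
  -- sum over the classes
  have hfib := hgsum.tsum_fiberwise (fun I : (Ideal (𝓞 K))⁰ ↦ ClassGroup.mk0 I)
  calc ∑ C, ‖classSumCont (thetaIdeal_inv_holds K) C s‖
      ≤ ∑ C, ∑' I : {I : (Ideal (𝓞 K))⁰ // ClassGroup.mk0 I = C}, g I.1 := Finset.sum_le_sum fun C _ ↦ hclass C
    _ = (dedekindZeta K (s.re : ℂ)).re := by rw [← hfib.tsum_eq, tsum_fintype]; rfl
    _ ≤ ‖dedekindZeta K (s.re : ℂ)‖ := Complex.re_le_norm _

/-- **`Σ_C |ζ(C, s)| ≤ e^{n_K/(σ − 1)}`** for `σ = Re s > 1`, uniformly in `K` (the tree's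
`norm_dedekindZeta_le_exp_finrank_div`). [folklore] -/
theorem sum_norm_classSumCont_le {s : ℂ} (hs : 1 < s.re) :
    ∑ C : ClassGroup (𝓞 K), ‖classSumCont (thetaIdeal_inv_holds K) C s‖ ≤
      Real.exp (Module.finrank ℚ K / (s.re - 1)) := by
  refine (sum_norm_classSumCont_le_norm_dedekindZeta hs).trans ?_
  have h := NumberField.norm_dedekindZeta_le_exp_finrank_div K (s := (s.re : ℂ)) (by simpa using hs)
  simpa using h

/-- `|Z_a(s)| ≤ e^{n_K/(σ − 1)}` for `σ > 1` and `|a| ≤ 1`. [folklore] -/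
theorem norm_classTwistedZeta_le_exp {a : ClassGroup (𝓞 K) → ℂ} (ha : ∀ C, ‖a C‖ ≤ 1) {s : ℂ}
    (hs : 1 < s.re) : ‖classTwistedZeta K a s‖ ≤ Real.exp (Module.finrank ℚ K / (s.re - 1)) :=
  (norm_classTwistedZeta_le ha s).trans (sum_norm_classSumCont_le hs)

/-! ### The exact modulus on `Re s = −1/2` -/

/-- **The functional equation on the line `Re s = −1/2`, in modulus**: for `Re s = −1/2` and the
duality permutation `σ`,
`|Z_a(s)| = |d_K| (|s|/2π)^{r₁} (|s||s+1|/4π²)^{r₂} |Z_{a∘σ}(1 − s)|` — from `Λ_{a∘σ}(1 − s) = Λ_a(s)`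
and the exact moduli of the gamma quotients at `1 − s = s̄ + 2` (the tree's
`norm_Gammaℝ_conj_add_two`, `norm_Gammaℂ_conj_add_two`; Rademacher's device). [cite: Rademacher1959, Thm. 4] -/
theorem norm_classTwistedZeta_eq_of_re_eq_neg_half {σ : ClassGroup (𝓞 K) ≃ ClassGroup (𝓞 K)}
    (hσ : ∀ (a : ClassGroup (𝓞 K) → ℂ) {s : ℂ}, (∀ n : ℤ, s ≠ n) →
      completedClassTwistedZeta K a (1 - s) = completedClassTwistedZeta K (a ∘ σ.symm) s)
    (a : ClassGroup (𝓞 K) → ℂ) {s : ℂ} (hs : s.re = -1 / 2) :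
    ‖classTwistedZeta K a s‖ =
      ((discr K).natAbs : ℝ) * (‖s‖ / (2 * Real.pi)) ^ nrRealPlaces K *
        (‖s‖ * ‖s + 1‖ / (2 * Real.pi) ^ 2) ^ nrComplexPlaces K * ‖classTwistedZeta K (a ∘ σ) (1 - s)‖ := by
  obtain ⟨hsZ, hs0, hs1⟩ := ne_int_of_re_eq_neg_half hs
  have h1s : 1 - s = starRingEnd ℂ s + 2 :=
    Complex.ext (by simp [hs]; norm_num) (by simp)
  have hFE := hσ (a ∘ σ) hsZ
  have hcomp : (a ∘ σ) ∘ σ.symm = a := by funext C; simp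
  rw [hcomp] at hFE
  unfold completedClassTwistedZeta dedekindGammaFactor at hFE
  have hn := congrArg norm hFE
  simp only [norm_mul, norm_pow] at hn
  have hdpos : 0 < (discr K).natAbs := Int.natAbs_pos.mpr (discr_ne_zero K)
  have hd : (0 : ℝ) < ((discr K).natAbs : ℝ) := by exact_mod_cast hdpos
  rw [norm_natCast_cpow_of_pos hdpos, norm_natCast_cpow_of_pos hdpos] at hn
  have hre1 : ((1 - s) / 2).re = 1 + (-1 / 4 : ℝ) := by simp [hs]; norm_num
  have hre2 : (s / 2).re = (-1 / 4 : ℝ) := by simp [hs]; norm_num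
  have hΓℝ : ‖Gammaℝ (1 - s)‖ = ‖Gammaℝ s‖ * ‖s‖ / (2 * Real.pi) := by
    rw [h1s]; exact norm_Gammaℝ_conj_add_two hs0
  have hΓℂ : ‖Gammaℂ (1 - s)‖ = ‖Gammaℂ s‖ * ‖s‖ * ‖s + 1‖ / (2 * Real.pi) ^ 2 := by
    rw [h1s]; exact norm_Gammaℂ_conj_add_two hs0 hs1
  rw [hre1, hre2, Real.rpow_add hd, Real.rpow_one, hΓℝ, hΓℂ] at hn
  have hg1 : 0 < ‖Gammaℝ s‖ := by
    refine norm_pos_iff.mpr ?_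
    rw [Ne, Gammaℝ_eq_zero_iff]
    rintro ⟨n, hn'⟩
    exact hsZ (-(2 * n)) (by rw [hn']; push_cast; ring)
  have hg2 : 0 < ‖Gammaℂ s‖ := by
    refine norm_pos_iff.mpr ?_
    rw [Gammaℂ_def]
    refine mul_ne_zero (mul_ne_zero two_ne_zero ?_) (Complex.Gamma_ne_zero fun m hm ↦ hsZ (-m) ?_)
    · rw [Ne, cpow_eq_zero_iff, not_and_or]
      exact Or.inl (mul_ne_zero two_ne_zero (ofReal_ne_zero.mpr Real.pi_ne_zero))
    · rw [hm]; push_cast; ring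
  have he : 0 < ((discr K).natAbs : ℝ) ^ (-1 / 4 : ℝ) := Real.rpow_pos_of_pos hd _
  have hP : ((discr K).natAbs : ℝ) ^ (-1 / 4 : ℝ) * ‖Gammaℝ s‖ ^ nrRealPlaces K *
      ‖Gammaℂ s‖ ^ nrComplexPlaces K ≠ 0 :=
    (mul_pos (mul_pos he (pow_pos hg1 _)) (pow_pos hg2 _)).ne'
  have key : ((discr K).natAbs : ℝ) ^ (-1 / 4 : ℝ) * ‖Gammaℝ s‖ ^ nrRealPlaces K *
      ‖Gammaℂ s‖ ^ nrComplexPlaces K * ‖classTwistedZeta K a s‖ =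
      ((discr K).natAbs : ℝ) ^ (-1 / 4 : ℝ) * ‖Gammaℝ s‖ ^ nrRealPlaces K *
        ‖Gammaℂ s‖ ^ nrComplexPlaces K *
        (((discr K).natAbs : ℝ) * (‖s‖ / (2 * Real.pi)) ^ nrRealPlaces K *
          (‖s‖ * ‖s + 1‖ / (2 * Real.pi) ^ 2) ^ nrComplexPlaces K *
            ‖classTwistedZeta K (a ∘ σ) (1 - s)‖) := by
    rw [← hn]; ring
  exact mul_left_cancel₀ hP key

/-! ### The convexity bound -/

/-- **Uniform convexity bound for `Z₁_a`** (`|a| ≤ 1`; Rademacher 1959, Thm. 4, in the simplified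
form of the tree's `norm_dedekindZeta₁_le`): for `Re z ≥ −1/2`,
`|Z₁_a(z)| ≤ |d_K| · e^{2 n_K} · |z + 5/2|^{n_K + 1}`.
Proof: Phragmén–Lindelöf (Rademacher) on `−1/2 ≤ σ ≤ 3/2`, `Q = 5/2`: on `σ = 3/2`,
`|Z₁_a| ≤ |z − 1| e^{2n_K}`; on `σ = −1/2`, by the exact functional equation and `|a∘σ| ≤ 1`,
`|Z₁_a| ≤ |d_K| e^{2n_K}|Q + z|^{n_K + 1}`; a-priori order `exists_norm_classTwistedZeta₁_le_exp_im`.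
[cite: Rademacher1959, Thm. 4] -/
theorem norm_classTwistedZeta₁_le {a : ClassGroup (𝓞 K) → ℂ} (ha : ∀ C, ‖a C‖ ≤ 1) {z : ℂ}
    (hz₁ : -1 / 2 ≤ z.re) :
    ‖classTwistedZeta₁ K a z‖ ≤ ((discr K).natAbs : ℝ) * Real.exp (2 * Module.finrank ℚ K) *
      ‖z + 5 / 2‖ ^ (Module.finrank ℚ K + 1) := by
  obtain ⟨σ, hσ⟩ := exists_perm_completedClassTwistedZeta_one_sub (K := K)
  set n : ℕ := Module.finrank ℚ K with hn
  set d : ℝ := ((discr K).natAbs : ℝ) with hd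
  set E : ℝ := Real.exp (2 * n) with hE
  have hd1 : 1 ≤ d := by
    rw [hd]; exact_mod_cast Int.natAbs_pos.mpr (discr_ne_zero K)
  have hd0 : 0 < d := by linarith
  have hE0 : 0 < E := Real.exp_pos _
  have hE1 : 1 ≤ E := Real.one_le_exp (by positivity)
  -- `|a ∘ τ| ≤ 1` for every permutation `τ`
  have haσ : ∀ C, ‖(a ∘ σ) C‖ ≤ 1 := fun C ↦ ha (σ C)
  -- the right half-plane bound `|Z₁_b(w)| ≤ |w − 1| e^{2n}` for `Re w ≥ 3/2`, any `|b| ≤ 1`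
  have hright : ∀ (b : ClassGroup (𝓞 K) → ℂ), (∀ C, ‖b C‖ ≤ 1) → ∀ w : ℂ, 3 / 2 ≤ w.re →
      ‖classTwistedZeta₁ K b w‖ ≤ ‖w - 1‖ * E := by
    intro b hb w hw
    have hw1 : 1 < w.re := by linarith
    have hw1' : w ≠ 1 := fun h ↦ by rw [h, one_re] at hw; norm_num at hw
    rw [classTwistedZeta₁_apply_of_ne_one b hw1', norm_mul]
    refine mul_le_mul_of_nonneg_left ((norm_classTwistedZeta_le_exp hb hw1).trans ?_) (norm_nonneg _)
    rw [hE, Real.exp_le_exp, div_le_iff₀ (by linarith)]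
    have : (0 : ℝ) ≤ n := Nat.cast_nonneg _
    nlinarith
  have hQz : ((5 / 2 : ℝ) : ℂ) + z = z + 5 / 2 := by push_cast; ring
  have hN2 : ∀ w : ℂ, -1 / 2 ≤ w.re → 2 ≤ ‖w + 5 / 2‖ := fun w hw ↦ by
    calc (2 : ℝ) ≤ |(w + 5 / 2).re| := by
          rw [abs_of_nonneg (by simp; linarith)]; simp; linarith
      _ ≤ ‖w + 5 / 2‖ := abs_re_le_norm _
  have hzm1 : ∀ w : ℂ, -1 / 2 ≤ w.re → ‖w - 1‖ ≤ ‖w + 5 / 2‖ := fun w hw ↦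
    norm_le_norm_of_sq_le (by simp; nlinarith)
  -- the case `3/2 ≤ Re z`: directly
  rcases le_or_gt (3 / 2 : ℝ) z.re with hz3 | hz3
  · have hN1 : 1 ≤ ‖z + 5 / 2‖ := le_trans (by norm_num) (hN2 z hz₁)
    calc ‖classTwistedZeta₁ K a z‖ ≤ ‖z - 1‖ * E := hright a ha z hz3
      _ ≤ ‖z + 5 / 2‖ * E := by gcongr; exact hzm1 z hz₁
      _ = 1 * E * ‖z + 5 / 2‖ ^ 1 := by ring
      _ ≤ d * E * ‖z + 5 / 2‖ ^ (n + 1) := by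
          gcongr
          all_goals omega
  -- the strip: Rademacher
  obtain ⟨C₁, hC₁, hgr₀⟩ := exists_norm_classTwistedZeta₁_le_exp_im (K := K) a
  have hgr : ∀ w : ℂ, (-1 / 2 : ℝ) < w.re → w.re < 3 / 2 →
      ‖classTwistedZeta₁ K a w‖ ≤ C₁ * Real.exp (|w.im| ^ (4 : ℝ)) := fun w hw1 hw2 ↦
    hgr₀ w (abs_le.mpr ⟨by linarith, by linarith⟩)
  -- right edge
  have hb : ∀ w : ℂ, w.re = 3 / 2 →
      ‖classTwistedZeta₁ K a w‖ ≤ E * ‖((5 / 2 : ℝ) : ℂ) + w‖ ^ (1 : ℝ) := by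
    intro w hw
    rw [Real.rpow_one, show ((5 / 2 : ℝ) : ℂ) + w = w + 5 / 2 by push_cast; ring]
    calc ‖classTwistedZeta₁ K a w‖ ≤ ‖w - 1‖ * E := hright a ha w hw.ge
      _ ≤ ‖w + 5 / 2‖ * E := by gcongr; exact hzm1 w (by rw [hw]; norm_num)
      _ = E * ‖w + 5 / 2‖ := mul_comm _ _
  -- left edge
  have hleft : ∀ w : ℂ, w.re = -1 / 2 →
      ‖classTwistedZeta₁ K a w‖ ≤ d * E * ‖((5 / 2 : ℝ) : ℂ) + w‖ ^ ((n + 1 : ℕ) : ℝ) := by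
    intro w hw
    obtain ⟨hwZ, hw0, hw1'⟩ := ne_int_of_re_eq_neg_half hw
    have hw1 : w ≠ 1 := fun h ↦ hwZ 1 (by simpa using h)
    rw [Real.rpow_natCast, show ((5 / 2 : ℝ) : ℂ) + w = w + 5 / 2 by push_cast; ring,
      classTwistedZeta₁_apply_of_ne_one a hw1, norm_mul,
      norm_classTwistedZeta_eq_of_re_eq_neg_half hσ a hw]
    set N : ℝ := ‖w + 5 / 2‖ with hN
    have hN2' : 2 ≤ N := hN2 w (by rw [hw])
    have hwN : ‖w‖ ≤ N := norm_le_norm_of_sq_le (by simp; nlinarith)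
    have hw1N : ‖w + 1‖ ≤ N := norm_le_norm_of_sq_le (by simp; nlinarith)
    have hwm1N : ‖w - 1‖ ≤ N := hzm1 w (by rw [hw])
    have hpi : 1 ≤ 2 * Real.pi := by linarith [Real.pi_gt_three]
    have hX : ‖w‖ / (2 * Real.pi) ≤ N := by
      rw [div_le_iff₀ (by positivity)]
      calc ‖w‖ ≤ N := hwN
        _ = N * 1 := (mul_one N).symm
        _ ≤ N * (2 * Real.pi) := by gcongr
    have hY : ‖w‖ * ‖w + 1‖ / (2 * Real.pi) ^ 2 ≤ N ^ 2 := by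
      rw [div_le_iff₀ (by positivity)]
      calc ‖w‖ * ‖w + 1‖ ≤ N * N := mul_le_mul hwN hw1N (norm_nonneg _) (by linarith)
        _ = N ^ 2 * 1 := by ring
        _ ≤ N ^ 2 * (2 * Real.pi) ^ 2 := by gcongr; nlinarith
    have h1w : 1 < (1 - w).re := by simp [hw]; norm_num
    have hZ : ‖classTwistedZeta K (a ∘ σ) (1 - w)‖ ≤ E := by
      refine (norm_classTwistedZeta_le_exp haσ h1w).trans (le_of_eq ?_)
      rw [hE]; congr 1
      simp [hw]; ring
    have hrank : nrRealPlaces K + 2 * nrComplexPlaces K = n := card_add_two_mul_card_eq_rank K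
    calc ‖w - 1‖ * (d * (‖w‖ / (2 * Real.pi)) ^ nrRealPlaces K *
          (‖w‖ * ‖w + 1‖ / (2 * Real.pi) ^ 2) ^ nrComplexPlaces K *
            ‖classTwistedZeta K (a ∘ σ) (1 - w)‖)
        ≤ N * (d * N ^ nrRealPlaces K * (N ^ 2) ^ nrComplexPlaces K * E) := by
          gcongr
      _ = d * E * N ^ (nrRealPlaces K + 2 * nrComplexPlaces K + 1) := by ring
      _ = d * E * N ^ (n + 1) := by rw [hrank]
  -- Rademacher's theorem
  have hβα : (1 : ℝ) ≤ ((n + 1 : ℕ) : ℝ) := by exact_mod_cast Nat.le_add_left 1 n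
  have hR := Literature.Analysis.Complex.rademacher_phragmenLindelof_of_finiteOrder
    (f := classTwistedZeta₁ K a) (a := -1 / 2) (b := 3 / 2) (Q := 5 / 2) (A := d * E) (B := E)
    (α := ((n + 1 : ℕ) : ℝ)) (β := 1) (C := C₁) (c := 4)
    (by norm_num) (by norm_num) (by positivity) hE0 hβα
    (differentiable_classTwistedZeta₁ a).diffContOnCl (by positivity) hgr hleft hb hz₁ hz3.le
  rw [hQz, Real.rpow_one] at hR
  set N : ℝ := ‖z + 5 / 2‖ with hN
  have hN2' : 2 ≤ N := hN2 z hz₁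
  have hN1 : 1 ≤ N := by linarith
  set X : ℝ := d * E * N ^ ((n + 1 : ℕ) : ℝ) with hX
  set Y : ℝ := E * N with hY
  have hY0 : 0 < Y := by positivity
  have hYX : Y ≤ X := by
    rw [hX, hY, Real.rpow_natCast]
    calc E * N = 1 * E * N ^ 1 := by ring
      _ ≤ d * E * N ^ (n + 1) := by
          gcongr
          all_goals omega
  have hX0 : 0 < X := hY0.trans_le hYX
  set p : ℝ := (3 / 2 - z.re) / (3 / 2 - -1 / 2) with hp
  set q : ℝ := (z.re - -1 / 2) / (3 / 2 - -1 / 2) with hq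
  have hp0 : 0 ≤ p := by rw [hp]; apply div_nonneg <;> linarith
  have hq0 : 0 ≤ q := by rw [hq]; apply div_nonneg <;> linarith
  have hpq : p + q = 1 := by rw [hp, hq]; field_simp; ring
  have hfin : X ^ p * Y ^ q ≤ X := by
    calc X ^ p * Y ^ q ≤ X ^ p * X ^ q := by gcongr
      _ = X := by rw [← Real.rpow_add hX0, hpq, Real.rpow_one]
  calc ‖classTwistedZeta₁ K a z‖ ≤ X ^ p * Y ^ q := hR
    _ ≤ X := hfin
    _ = d * E * N ^ (n + 1) := by rw [hX, Real.rpow_natCast]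

/-- **Uniform convexity bound for the `L`-functions of class group characters**: for every number
field `K`, every `χ : Cl_K →* ℂˣ` and every `z ≠ 1` with `Re z ≥ −1/2`,
`|(z − 1) L(z, χ)| ≤ |d_K| · e^{2 n_K} · |z + 5/2|^{n_K + 1}` — polynomial growth in the
conductor `|d_K|` and the height, with absolute numerical constants, the input of the zero
counting and zero-free region for `L(s, χ, H_K/K)` ([ThornerZaman2019, Lemmas 2.5–2.6, Thm. 3.1]).
[cite: Rademacher1959, Thm. 4] -/
theorem norm_sub_one_mul_classGroupLFunction_le (χ : ClassGroup (𝓞 K) →* ℂˣ) {z : ℂ} (hz : z ≠ 1)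
    (hz₁ : -1 / 2 ≤ z.re) :
    ‖(z - 1) * classGroupLFunction K χ z‖ ≤
      ((discr K).natAbs : ℝ) * Real.exp (2 * Module.finrank ℚ K) *
        ‖z + 5 / 2‖ ^ (Module.finrank ℚ K + 1) := by
  rw [sub_one_mul_classGroupLFunction χ hz]
  exact norm_classTwistedZeta₁_le (fun C ↦ (norm_classGroupChar_apply χ C).le) hz₁

end Literature.NumberTheory.LFunctions.NumberField

end
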